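import Summits.CriticalPhenomena.SAWScalingLimit.Theses.SAWRenewalTightness
import Summits.CriticalPhenomena.SAWScalingLimit.Theorems.SAWRenewalTightnessShellCrossingBoundSocketTransfer
import Summits.CriticalPhenomena.SAWScalingLimit.Theorems.SAWRenewalTightnessShellCrossingBoundSocketedEnlargement
import Summits.CriticalPhenomena.SAWScalingLimit.Theorems.SAWRenewalTightnessShellCrossingBoundOfPinchAway
import Literature.Probability.RandomPlanarGeometry.CurvePinch
import HarnessLib

/-!
# LINE `confinement-bulk-tightness` — crux `ShellCrossingBound` (stmt-CriticalPhenomena-4728): the summit-safe split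

Crux-strategist skeleton (wall-breaker gen 1).  TWO registered stubs and a KERNEL-CHECKED composition
`ShellCrossingBound_of : stub₁-statement → stub₂-statement → ShellCrossingBound` (no `sorry` outside the stubs):

* **Sub₁ `ConfinementPositivity`** (restriction positivity; verbatim the audited statement
  `stub_confinementPositivity` of line `pinch-on-a-circle`, `⟺ liminf Z_{D'}/Z_D > 0` by
  `Theorems/…ConfinementRatio.lean`, implied by `SAWScalingLimit` by
  `Theorems/…ConfinementOfScalingLimit.lean`): for nested Dobrushin domains `D' ⊆ D` with the same
  marked points and `D ∩ (B(a, d) ∪ B(b, d)) ⊆ D'`, the critical SAW of `D_δ` stays inside `D'_δ` with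
  probability `≥ c > 0` for all small `δ`.
* **Sub₂ `BulkShellTight`** (per-shell TIGHTNESS of the traversal count on INTERIOR shells — no
  fixed threshold, no rate, no power law): for every Dobrushin domain with an endpoint approximation,
  every shell `D(y; η, R)` with `0 < η < R` and `B̄(y, 2R) ⊆ Ω`, and every `ε > 0`, some threshold `j`
  and mesh bound `δ₁ > 0` give `P_δ[j separate traversals of D(y; η, R)] ≤ ε` for `δ ∈ (0, δ₁]`.
  (A consequence of the crux — hence of the summit, `EventualTight.Negative.TightnessNecessary` — by
  `shellCrossingBound_iff_shellCountTight`; strictly weaker than the fixed-threshold bulk statements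
  `ShellCrossingBoundBulkAt 4` / `stub_bulkTwoStrandPinch` of the dead lines.)

**Theorem `ShellCrossingBound_of : Sub₁ → Sub₂ → ShellCrossingBound` (the crux BY NAME).**  The boundary of the
domain (fjords, corridors, deep lattice endpoints) contributes NOTHING to the crux beyond restriction
positivity: every shell bound is obtained on interior shells of a socketed enlargement and pulled
back by the exact restriction covariance of the critical SAW law.

Proof.  Fix `(D, a, b)` with an endpoint approximation; by the landed coarse-mesh glue
`shellCrossing_of_perShellDecay` it suffices to prove per-shell decay: for a genuine shell
`D(x; ρ, R)` and `ε > 0` find `k, δ₁`.  (1) `exists_good_mid`: a middle radius `m` of a third of the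
shell at distance `≥ (R−ρ)/12 = 2d` (`d := (R−ρ)/24`) from `dist(a, x)` and `dist(b, x)`; sub-shell
`D(x; m − w/2, m + w/2)`, `w = (R−ρ)/3`.  (2) `stub_socketedEnlargement` at `d`: a Dobrushin domain
`D̂ ⊇ D`, same marked points, sockets `D̂ ∩ (B(a, d/2) ∪ B(b, d/2)) ⊆ D`, collar `B̄(z, ε₀) ⊆ D̂` for
`z ∈ Ω̄` at distance `≥ d` from both marked points; nesting of the discrete domains for `δ ≤ δ₃`
(`JordanDomain.exists_forall_meshDomain_subset`, `exists_domainSAW_of_meshDomain_subset`), so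
`(a_δ, b_δ)` is an endpoint approximation of `D̂` too; Sub₁ for the pair `D ⊆ D̂`: `P_D̂(γ ⊆ D_δ) ≥ c`.
(3) A net of `M` points `yᵢ` on the circle `|y − x| = m`, resolution `η = 2πm/M < min(R′, d)`,
`R′ = min(w/4, ε₀/4)`.  (4) For each net point: either no point of `Ω̄` is within `η` of `yᵢ` — then
no SAW polyline traverses `D(yᵢ; η, R′)` even once (`exists_mem_closure_of_hasTraversals`); or some
`z ∈ Ω̄` has `dist z yᵢ ≤ η`, whence `z` is `d`-far from the marked points and
`B̄(yᵢ, 2R′) ⊆ B̄(z, ε₀) ⊆ D̂`: Sub₂ in `D̂` gives `jᵢ, δᵢ` with `P_D̂[jᵢ traversals of D(yᵢ; η, R′)] ≤ εc/M`,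
and restriction covariance (`SAW.law_mul_law_setOf_exists_support_eq_le`) transfers it to
`P_D[…] ≤ ε/M`.  (5) `k := M·J + 1`, `J = max jᵢ`: `k` separate traversals of `D(x; ρ, R)` traverse
the sub-shell, pass the middle circle (`Curve.exists_mem_sphere_of_isTraversal`), pigeonhole puts
`J + 1` passage points in one net cell (`exists_netPoint_hasTraversals`, ONE traversal of the small
shell per strand: far endpoint → passage point), so `D(yᵢ; η, R′)` is traversed `J + 1 > jᵢ` times;
union bound over the net: `P_D[k traversals] ≤ M · ε/M = ε` for `δ ≤ min δᵢ`.

Folklore lattice/plane geometry around the Aizenman–Burchard criterion and the Lawler–Schramm–Werner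
restriction property; no named fact.  Mathlib anchors: `Finset.exists_lt_card_fiber_of_mul_lt_card_of_maps_to`,
`Finset.exists_subset_card_eq`, `Finset.orderEmbOfFin`, `MeasureTheory.measure_iUnion_fintype_le`,
`Metric.closedBall_subset_closedBall'`, `Ioc_mem_nhdsGT`.  H21 anchors: `Theorems.stub_socketedEnlargement`
(p97679), `JordanDomain.exists_forall_meshDomain_subset`, `exists_domainSAW_of_meshDomain_subset`,
`exists_mem_closure_of_hasTraversals`, `le_ofReal_div_mul_of_mul_ofReal_le` (p98857),
`shellCrossing_of_perShellDecay` (p107371), `SAW.law_mul_law_setOf_exists_support_eq_le`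
(`SAWRestrictionCovariance.lean`), `exists_good_mid`, `exists_dist_circleNet_le`,
`Curve.exists_mem_sphere_of_isTraversal` (`CurvePinch.lean`), `Curve.HasTraversals.mono'/of_le`
(`CurveTortuosity.lean`). [cite: AizenmanBurchardDuke1999, §1.b and Lemma 3.1]
[cite: LawlerSchrammWerner2004SAW, §3]
-/

noncomputable section
open MeasureTheory Set Metric Filter Topology
open scoped unitInterval ENNReal Real
open Literature.Probability.RandomPlanarGeometry Literature.Probability.LatticeModels

namespace Summit.CriticalPhenomena.SAWScalingLimit.Cruxes.ShellCrossingBound.ConfinementBulkTightness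

open Summit.CriticalPhenomena.SAWScalingLimit.Theorems

/-! ### Pigeonhole on a circle net, one traversal per strand -/

/-- **Net pigeonhole.** If a planar curve makes `M·J + 1` separate traversals of `D(x; ρ₁, R₁)` and
`ρ₁ < r < R₁`, `0 < r`, then for one of the `M` net points `yᵢ = x + r e^{i(−π + 2πi/M)}` of the
circle `|y − x| = r` the curve makes `J + 1` separate traversals of the small shell
`D(yᵢ; 2πr/M, R′)`, for any `R′ ≤ min (r − ρ₁) (R₁ − r)`: each traversal passes the circle
(intermediate value theorem) within `2πr/M` of a net point (`exists_dist_circleNet_le`), `J + 1` of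
the `M·J + 1` passage points share a net point (pigeonhole), and for each of these strands the segment
from its start (at distance `≥ R′` from `yᵢ`) to its passage point is ONE traversal of the small
shell; disjointness of the parameter intervals is inherited. [cite: AizenmanBurchardDuke1999, §1.b] -/
theorem exists_netPoint_hasTraversals {γ : Curve ℂ} {x : ℂ} {ρ₁ R₁ r R' : ℝ} {M J : ℕ}
    (hρr : ρ₁ < r) (hrR : r < R₁) (hr : 0 < r) (hin : R' ≤ r - ρ₁) (hout : R' ≤ R₁ - r)
    (hM : 1 ≤ M) (h : γ.HasTraversals (M * J + 1) x ρ₁ R₁) :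
    ∃ i : ℕ, i < M ∧ γ.HasTraversals (J + 1)
      (x + (r : ℂ) * Complex.exp (((-π + 2 * π * i / M : ℝ) : ℂ) * Complex.I)) (2 * π * r / M) R' := by
  classical
  obtain ⟨s, t, hst, hsep⟩ := h
  -- the net points
  let N : ℕ → ℂ := fun i => x + (r : ℂ) * Complex.exp (((-π + 2 * π * i / M : ℝ) : ℂ) * Complex.I)
  have hNdist : ∀ i, dist (N i) x = r := fun i => by
    show dist (x + (r : ℂ) * Complex.exp (((-π + 2 * π * i / M : ℝ) : ℂ) * Complex.I)) x = r
    rw [dist_eq_norm, add_sub_cancel_left, norm_mul, Complex.norm_real, Real.norm_eq_abs,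
      abs_of_nonneg hr.le, Complex.norm_exp_ofReal_mul_I, mul_one]
  -- passage times through the circle of radius `r`
  have hm : ∀ l, ∃ m : I, s l < m ∧ m ≤ t l ∧ dist (γ m) x = r := fun l =>
    Curve.exists_mem_sphere_of_isTraversal hρr hrR (hst l)
  choose mm hsm hmt hmr using hm
  -- the net cell of each passage point
  have hcell : ∀ l, ∃ i : ℕ, i < M ∧ dist (γ (mm l)) (N i) ≤ 2 * π * r / M := fun l =>
    exists_dist_circleNet_le hr (hmr l) hM
  choose cell hcellM hcelld using hcell
  -- pigeonhole: `J + 1` strands in one cell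
  let f : Fin (M * J + 1) → Fin M := fun l => ⟨cell l, hcellM l⟩
  obtain ⟨y, -, hy⟩ := Finset.exists_lt_card_fiber_of_mul_lt_card_of_maps_to
    (s := Finset.univ) (t := Finset.univ) (f := f) (fun l _ => Finset.mem_univ _) (n := J)
    (by rw [Finset.card_univ, Finset.card_univ, Fintype.card_fin, Fintype.card_fin]; omega)
  obtain ⟨T, hTS, hTcard⟩ := Finset.exists_subset_card_eq (Nat.succ_le_of_lt hy)
  let e := T.orderEmbOfFin hTcard
  have hcy : ∀ p, cell (e p) = (y : ℕ) := fun p => by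
    have hmem : e p ∈ T := T.orderEmbOfFin_mem hTcard p
    have hfy : f (e p) = y := (Finset.mem_filter.mp (hTS hmem)).2
    exact congrArg Fin.val hfy
  refine ⟨y, y.isLt, fun p => s (e p), fun p => mm (e p), fun p => ?_, fun p q hpq => ?_⟩
  · -- one traversal per strand: far start → passage point near the net point
    refine ⟨(hsm (e p)).le, Or.inr ⟨?_, ?_⟩⟩
    · -- the start of the strand is `≥ R'` away from the net point
      have hyx : dist (N y) x = r := hNdist y
      rcases (hst (e p)).2 with ⟨hs, -⟩ | ⟨hs, -⟩
      · have h1 := dist_triangle (N y) (γ (s (e p))) x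
        rw [dist_comm (N y) (γ (s (e p)))] at h1
        show R' ≤ dist (γ (s (e p))) (N y)
        linarith
      · have h1 := dist_triangle (γ (s (e p))) (N y) x
        show R' ≤ dist (γ (s (e p))) (N y)
        linarith
    · -- the passage point is within `2πr/M` of the net point
      have h1 := hcelld (e p)
      rw [hcy p] at h1
      exact h1
  · -- separation of the parameter intervals
    exact lt_of_le_of_lt (hmt (e p)) (hsep (e.strictMono hpq))

/-! ### The two registered stubs -/

/-- **STUB 1 `stub_confinementPositivity` (Sub₁, restriction positivity; OPEN, rate-free RSW-type lower bound;
`⟺ liminf Z_{D'}/Z_D > 0` by `Theorems/…ConfinementRatio.lean` p103341; implied by `SAWScalingLimit` by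
`Theorems/…ConfinementOfScalingLimit.lean` p105757).** For nested Dobrushin domains `D' ⊆ D` with the same marked points
and common sockets, the critical SAW of `D_δ` is a `D'_δ`-walk with probability `≥ c > 0` for all small `δ`. [conjecture-grade] -/
theorem stub_confinementPositivity :
    ∀ (D D' : DobrushinDomain) (a b : ℝ → Site 2) (d : ℝ), 0 < d → D'.carrier ⊆ D.carrier → D'.pt 0 = D.pt 0 → D'.pt 1 = D.pt 1 → D.carrier ∩ (Metric.ball (D.pt 0) d ∪ Metric.ball (D.pt 1) d) ⊆ D'.carrier → SAW.IsEndpointApprox D' a b → ∃ c δ₀ : ℝ, 0 < c ∧ 0 < δ₀ ∧ ∀ δ ∈ Set.Ioc (0 : ℝ) δ₀, ENNReal.ofReal c ≤ SAW.law D.carrier δ (a δ) (b δ) {γ | ∃ γ' : SAW.DomainSAW D'.carrier δ (a δ) (b δ), γ'.walk.support = γ.walk.support} := by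
  sorry

/-- **STUB 2 `stub_bulkShellTight` (Sub₂, per-shell TIGHTNESS of the traversal count on interior shells; OPEN; a
consequence of the crux by `shellCrossingBound_iff_shellCountTight` p108667, hence of the summit — no fixed threshold, no
rate).** For every Dobrushin domain with an endpoint approximation, every interior shell `D(y; η, R)` (`B̄(y, 2R) ⊆ Ω`) and
every `ε > 0`, some threshold `j` and mesh bound `δ₁ > 0` give `P_δ[j separate traversals] ≤ ε` for `δ ∈ (0, δ₁]`.
The bulk multi-strand atom of the whole tightness programme lives here (virgin-disc form X2 reachable by exact
two-sided virginization, the shells being interior). [conjecture-grade] -/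
theorem stub_bulkShellTight :
    ∀ (D : DobrushinDomain) (a b : ℝ → Site 2), SAW.IsEndpointApprox D a b → ∀ (y : ℂ) (η R : ℝ), 0 < η → η < R → Metric.closedBall y (2 * R) ⊆ D.carrier → ∀ ε : ℝ, 0 < ε → ∃ (j : ℕ) (δ₁ : ℝ), 0 < δ₁ ∧ ∀ δ ∈ Set.Ioc (0 : ℝ) δ₁, SAW.law D.carrier δ (a δ) (b δ) {γ | (⟨γ.walk.toCurve (meshPoint δ)⟩ : Curve ℂ).HasTraversals j y η R} ≤ ENNReal.ofReal ε := by
  sorry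

/-! ### The composition (kernel-checked, no sorry) -/

/-- **Composition of the line (= the summit-safe decomposition of the crux `ShellCrossingBound`, stmt-CriticalPhenomena-4728):**
`stub_confinementPositivity-statement → stub_bulkShellTight-statement → ShellCrossingBound` BY NAME — restriction positivity for nested
Dobrushin domains with common marked-point sockets, plus per-shell tightness of the traversal count on
INTERIOR shells (`B̄(y, 2R) ⊆ Ω`; no fixed threshold, no rate), give the Aizenman–Burchard shell bound
with its shell-dependent threshold in EVERY Dobrushin domain with an endpoint approximation.  See the
module docstring for the proof (good middle circle; socketed enlargement; nesting; finite net; for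
each net point either an empty event or an interior small shell of the enlargement, bounded by
`BulkShellTight` there and transferred by restriction covariance and `ConfinementPositivity`; net
pigeonhole `exists_netPoint_hasTraversals`; union bound; `shellCrossing_of_perShellDecay`).
[cite: AizenmanBurchardDuke1999, §1.b and Lemma 3.1] [cite: LawlerSchrammWerner2004SAW, §3] -/
theorem ShellCrossingBound_of :
    (∀ (D D' : DobrushinDomain) (a b : ℝ → Site 2) (d : ℝ), 0 < d →
      D'.carrier ⊆ D.carrier → D'.pt 0 = D.pt 0 → D'.pt 1 = D.pt 1 →
      D.carrier ∩ (Metric.ball (D.pt 0) d ∪ Metric.ball (D.pt 1) d) ⊆ D'.carrier →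
      SAW.IsEndpointApprox D' a b →
        ∃ c δ₀ : ℝ, 0 < c ∧ 0 < δ₀ ∧ ∀ δ ∈ Set.Ioc (0 : ℝ) δ₀,
          ENNReal.ofReal c ≤ SAW.law D.carrier δ (a δ) (b δ)
            {γ | ∃ γ' : SAW.DomainSAW D'.carrier δ (a δ) (b δ),
              γ'.walk.support = γ.walk.support}) →
    (∀ (D : DobrushinDomain) (a b : ℝ → Site 2), SAW.IsEndpointApprox D a b →
      ∀ (y : ℂ) (η R : ℝ), 0 < η → η < R → Metric.closedBall y (2 * R) ⊆ D.carrier →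
        ∀ ε : ℝ, 0 < ε → ∃ (j : ℕ) (δ₁ : ℝ), 0 < δ₁ ∧ ∀ δ ∈ Set.Ioc (0 : ℝ) δ₁,
          SAW.law D.carrier δ (a δ) (b δ)
            {γ | (⟨γ.walk.toCurve (meshPoint δ)⟩ : Curve ℂ).HasTraversals j y η R} ≤
            ENNReal.ofReal ε) →
    Summit.CriticalPhenomena.SAWScalingLimit.Theses.SAWRenewalTightness.ShellCrossingBound := by
  intro hE hB D a b hab
  classical
  refine shellCrossing_of_perShellDecay D a b fun x ρ R hρ hρR ε hε => ?_
  /- (1) a good middle radius and its sub-shell -/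
  obtain ⟨m, hm1, hm2, hfa, hfb⟩ := exists_good_mid hρR (dist (D.pt 0) x) (dist (D.pt 1) x)
  set w : ℝ := (R - ρ) / 3 with hw_def
  have hw : 0 < w := by rw [hw_def]; linarith
  have h6 : (R - ρ) / 6 = w / 2 := by rw [hw_def]; ring
  have hρm : ρ + w / 2 ≤ m := by linarith
  have hmR : m + w / 2 ≤ R := by linarith
  have hmpos : 0 < m := by linarith
  set ρ₁ : ℝ := m - w / 2 with hρ₁_def
  set R₁ : ℝ := m + w / 2 with hR₁_def
  have hρρ₁ : ρ ≤ ρ₁ := by rw [hρ₁_def]; linarith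
  have hR₁R : R₁ ≤ R := by rw [hR₁_def]; linarith
  have hρ₁m : ρ₁ < m := by rw [hρ₁_def]; linarith
  have hmR₁ : m < R₁ := by rw [hR₁_def]; linarith
  /- (2) the socketed enlargement at `d = w/8 = (R - ρ)/24`, nesting, confinement -/
  set d : ℝ := w / 8 with hd_def
  have hd : 0 < d := by positivity
  have h2d : 2 * d = (R - ρ) / 12 := by rw [hd_def, hw_def]; ring
  obtain ⟨D', ε₀, hε₀, hsub, hpt0, hpt1, hsock, hroom⟩ := stub_socketedEnlargement D d hd
  obtain ⟨δ₃, hδ₃, hnest⟩ :=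
    D.toJordanDomain.exists_forall_meshDomain_subset D'.toJordanDomain hsub
  have hN : ∀ δ : ℝ, 0 < δ → δ ≤ δ₃ → ∀ {u v : Site 2} (γ' : SAW.DomainSAW D.carrier δ u v),
      ∃ γ : SAW.DomainSAW D'.carrier δ u v, γ.walk.support = γ'.walk.support :=
    fun δ hδ hδ' _ _ γ' => exists_domainSAW_of_meshDomain_subset hsub (hnest δ hδ hδ') γ'
  -- `(a_δ, b_δ)` is an endpoint approximation of the enlargement as well
  have hab' : SAW.IsEndpointApprox D' a b := by
    refine ⟨?_, ?_, ?_⟩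
    · filter_upwards [hab.reachable, Ioc_mem_nhdsGT hδ₃] with δ hr hδ
      obtain ⟨p⟩ := hr
      obtain ⟨γ, -⟩ := hN δ hδ.1 hδ.2 ⟨p.bypass, p.bypass_isPath⟩
      exact γ.walk.reachable
    · rw [hpt0]; exact hab.tendsto_fst
    · rw [hpt1]; exact hab.tendsto_snd
  -- confinement positivity for the pair `D ⊆ D̂` with sockets of radius `d/2`
  have hsock' : D'.carrier ∩ (ball (D'.pt 0) (d / 2) ∪ ball (D'.pt 1) (d / 2)) ⊆ D.carrier := by
    rw [hpt0, hpt1]; exact hsock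
  obtain ⟨c, δ₂, hc, hδ₂, hconf⟩ :=
    hE D' D a b (d / 2) (by positivity) hsub hpt0.symm hpt1.symm hsock' hab
  /- (3) radii of the small shells, resolution and size of the net -/
  set R' : ℝ := min (w / 4) (ε₀ / 4) with hR'_def
  have hR' : 0 < R' := lt_min (by positivity) (by positivity)
  have hR'w : R' ≤ w / 4 := min_le_left _ _
  have hR'ε : R' ≤ ε₀ / 4 := min_le_right _ _
  set η₀ : ℝ := min R' d / 2 with hη₀_def
  have hmin : 0 < min R' d := lt_min hR' hd
  have hη₀ : 0 < η₀ := by rw [hη₀_def]; positivity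
  have hη₀R' : η₀ < R' := by
    have := min_le_left R' d
    rw [hη₀_def]; linarith
  have hη₀d : η₀ < d := by
    have := min_le_right R' d
    rw [hη₀_def]; linarith
  set M : ℕ := ⌈2 * π * m / η₀⌉₊ + 1 with hM_def
  have hM1 : 1 ≤ M := by omega
  have hMpos : (0 : ℝ) < M := by exact_mod_cast (show 0 < M by omega)
  have hMgt : 2 * π * m / η₀ < M := by
    have h1 := Nat.le_ceil (2 * π * m / η₀)
    have h2 : (M : ℝ) = (⌈2 * π * m / η₀⌉₊ : ℝ) + 1 := by rw [hM_def]; push_cast; ring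
    rw [h2]
    linarith
  set η : ℝ := 2 * π * m / M with hη_def
  have hη : 0 < η := by rw [hη_def]; positivity
  have hηη₀ : η < η₀ := by
    rw [hη_def, div_lt_iff₀ hMpos]
    have h1 := (div_lt_iff₀ hη₀).1 hMgt
    linarith [mul_comm (M : ℝ) η₀]
  have hηR' : η < R' := hηη₀.trans hη₀R'
  have hηd : η ≤ d := (hηη₀.trans hη₀d).le
  -- the net points
  let N : ℕ → ℂ := fun i => x + (m : ℂ) * Complex.exp (((-π + 2 * π * i / M : ℝ) : ℂ) * Complex.I)
  have hNdist : ∀ i, dist (N i) x = m := fun i => by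
    show dist (x + (m : ℂ) * Complex.exp (((-π + 2 * π * i / M : ℝ) : ℂ) * Complex.I)) x = m
    rw [dist_eq_norm, add_sub_cancel_left, norm_mul, Complex.norm_real, Real.norm_eq_abs,
      abs_of_nonneg hmpos.le, Complex.norm_exp_ofReal_mul_I, mul_one]
  -- the net points are `2d = (R - ρ)/12` away from the marked points
  have hfar : ∀ (p : ℂ) (i : ℕ), (R - ρ) / 12 ≤ |dist p x - m| → 2 * d ≤ dist (N i) p := by
    intro p i hp
    have h1 := abs_dist_sub_le p (N i) x
    rw [hNdist i] at h1
    rw [dist_comm, h2d]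
    linarith
  /- (4) the bound at each net point: empty event, or an interior shell of `D̂` transferred to `D` -/
  set ε' : ℝ := ε / M with hε'_def
  have hε' : 0 < ε' := div_pos hε hMpos
  have key : ∀ i : Fin M, ∃ (j : ℕ) (δi : ℝ), 0 < δi ∧ ∀ δ ∈ Set.Ioc (0 : ℝ) δi,
      SAW.law D.carrier δ (a δ) (b δ)
        {γ | (⟨γ.walk.toCurve (meshPoint δ)⟩ : Curve ℂ).HasTraversals j (N i) η R'} ≤
        ENNReal.ofReal ε' := by
    intro i
    by_cases hA : ∃ z ∈ closure D.carrier, dist z (N i) ≤ η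
    · obtain ⟨z, hz, hzy⟩ := hA
      -- `z` is `d`-far from the marked points
      have hz0 : d ≤ dist z (D.pt 0) := by
        have h1 := hfar (D.pt 0) i hfa
        have h2 := dist_triangle (N i) z (D.pt 0)
        rw [dist_comm] at hzy
        linarith
      have hz1 : d ≤ dist z (D.pt 1) := by
        have h1 := hfar (D.pt 1) i hfb
        have h2 := dist_triangle (N i) z (D.pt 1)
        rw [dist_comm] at hzy
        linarith
      -- the ball `B̄(N i, 2R')` is interior in `D̂`
      have hball : closedBall (N i) (2 * R') ⊆ D'.carrier := by
        refine (closedBall_subset_closedBall' ?_).trans (hroom z hz hz0 hz1)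
        rw [dist_comm] at hzy
        linarith
      obtain ⟨j, δF, hδF, hbig⟩ :=
        hB D' a b hab' (N i) η R' hη hηR' hball (ε' * c) (mul_pos hε' hc)
      refine ⟨j, min δF (min δ₂ δ₃), lt_min hδF (lt_min hδ₂ hδ₃), fun δ hδ => ?_⟩
      have hδF' : δ ∈ Set.Ioc (0 : ℝ) δF := ⟨hδ.1, hδ.2.trans (min_le_left _ _)⟩
      have hδ2 : δ ∈ Set.Ioc (0 : ℝ) δ₂ :=
        ⟨hδ.1, hδ.2.trans ((min_le_right _ _).trans (min_le_left _ _))⟩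
      have hδ3 : δ ≤ δ₃ := hδ.2.trans ((min_le_right _ _).trans (min_le_right _ _))
      have hcov : SAW.law D.carrier δ (a δ) (b δ)
            {γ | (⟨γ.walk.toCurve (meshPoint δ)⟩ : Curve ℂ).HasTraversals j (N i) η R'} *
          SAW.law D'.carrier δ (a δ) (b δ)
            {γ | ∃ γ' : SAW.DomainSAW D.carrier δ (a δ) (b δ),
              γ'.walk.support = γ.walk.support} ≤
          SAW.law D'.carrier δ (a δ) (b δ)
            {γ | (⟨γ.walk.toCurve (meshPoint δ)⟩ : Curve ℂ).HasTraversals j (N i) η R'} :=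
        SAW.law_mul_law_setOf_exists_support_eq_le (hN δ hδ.1 hδ3)
          {γc : Curve ℂ | γc.HasTraversals j (N i) η R'}
      have hprod : SAW.law D.carrier δ (a δ) (b δ)
            {γ | (⟨γ.walk.toCurve (meshPoint δ)⟩ : Curve ℂ).HasTraversals j (N i) η R'} *
          ENNReal.ofReal c ≤ ENNReal.ofReal (ε' * c * 1) :=
        calc SAW.law D.carrier δ (a δ) (b δ)
                {γ | (⟨γ.walk.toCurve (meshPoint δ)⟩ : Curve ℂ).HasTraversals j (N i) η R'} *
              ENNReal.ofReal c
            ≤ SAW.law D.carrier δ (a δ) (b δ)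
                {γ | (⟨γ.walk.toCurve (meshPoint δ)⟩ : Curve ℂ).HasTraversals j (N i) η R'} *
              SAW.law D'.carrier δ (a δ) (b δ)
                {γ | ∃ γ' : SAW.DomainSAW D.carrier δ (a δ) (b δ),
                  γ'.walk.support = γ.walk.support} := mul_le_mul' le_rfl (hconf δ hδ2)
          _ ≤ SAW.law D'.carrier δ (a δ) (b δ)
                {γ | (⟨γ.walk.toCurve (meshPoint δ)⟩ : Curve ℂ).HasTraversals j (N i) η R'} := hcov
          _ ≤ ENNReal.ofReal (ε' * c) := hbig δ hδF'
          _ = ENNReal.ofReal (ε' * c * 1) := by rw [mul_one]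
      have hdiv := le_ofReal_div_mul_of_mul_ofReal_le hc hprod
      have hcalc : ε' * c / c * 1 = ε' := by field_simp
      rwa [hcalc] at hdiv
    · -- no point of `Ω̄` within `η` of the net point: no polyline traverses the small shell
      refine ⟨1, 1, one_pos, fun δ hδ => ?_⟩
      have hempty : {γ : SAW.DomainSAW D.carrier δ (a δ) (b δ) |
          (⟨γ.walk.toCurve (meshPoint δ)⟩ : Curve ℂ).HasTraversals 1 (N i) η R'} = ∅ :=
        Set.eq_empty_iff_forall_notMem.2 fun γ hγ =>
          hA (exists_mem_closure_of_hasTraversals γ.walk one_ne_zero hηR' hγ)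
      rw [hempty, measure_empty]
      exact bot_le
  choose j δi hδi hbound using key
  /- (5) thresholds, net pigeonhole and the union bound -/
  haveI : NeZero M := ⟨by omega⟩
  set J : ℕ := Finset.univ.sup j with hJ_def
  have hjJ : ∀ i, j i ≤ J := fun i => Finset.le_sup (f := j) (Finset.mem_univ i)
  set δ₁ : ℝ := Finset.univ.inf' Finset.univ_nonempty δi with hδ₁_def
  have hδ₁ : 0 < δ₁ := (Finset.lt_inf'_iff _).2 fun i _ => hδi i
  have hδ₁le : ∀ i, δ₁ ≤ δi i := fun i => Finset.inf'_le _ (Finset.mem_univ i)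
  refine ⟨M * J + 1, δ₁, hδ₁, fun δ hδ => ?_⟩
  -- the event inclusion
  have hsubev : {γ : SAW.DomainSAW D.carrier δ (a δ) (b δ) |
        (⟨γ.walk.toCurve (meshPoint δ)⟩ : Curve ℂ).HasTraversals (M * J + 1) x ρ R} ⊆
      ⋃ i : Fin M, {γ | (⟨γ.walk.toCurve (meshPoint δ)⟩ : Curve ℂ).HasTraversals (j i) (N i) η R'} := by
    intro γ hγ
    have h1 : (⟨γ.walk.toCurve (meshPoint δ)⟩ : Curve ℂ).HasTraversals (M * J + 1) x ρ₁ R₁ :=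
      Curve.HasTraversals.mono' hγ hρρ₁ hR₁R
    have hin : R' ≤ m - ρ₁ := by rw [hρ₁_def]; linarith
    have hout : R' ≤ R₁ - m := by rw [hR₁_def]; linarith
    obtain ⟨i, hiM, htrav⟩ := exists_netPoint_hasTraversals hρ₁m hmR₁ hmpos hin hout hM1 h1
    refine Set.mem_iUnion.2 ⟨⟨i, hiM⟩, ?_⟩
    have hle : j ⟨i, hiM⟩ ≤ J + 1 := (hjJ ⟨i, hiM⟩).trans (Nat.le_succ J)
    exact Curve.HasTraversals.of_le htrav hle
  calc SAW.law D.carrier δ (a δ) (b δ) {γ : SAW.DomainSAW D.carrier δ (a δ) (b δ) |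
          (⟨γ.walk.toCurve (meshPoint δ)⟩ : Curve ℂ).HasTraversals (M * J + 1) x ρ R}
      ≤ SAW.law D.carrier δ (a δ) (b δ)
          (⋃ i : Fin M, {γ | (⟨γ.walk.toCurve (meshPoint δ)⟩ : Curve ℂ).HasTraversals (j i) (N i) η R'}) :=
        measure_mono hsubev
    _ ≤ ∑ i : Fin M, SAW.law D.carrier δ (a δ) (b δ)
          {γ | (⟨γ.walk.toCurve (meshPoint δ)⟩ : Curve ℂ).HasTraversals (j i) (N i) η R'} :=
        measure_iUnion_fintype_le _ _
    _ ≤ ∑ _i : Fin M, ENNReal.ofReal ε' :=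
        Finset.sum_le_sum fun i _ => hbound i δ ⟨hδ.1, hδ.2.trans (hδ₁le i)⟩
    _ = ENNReal.ofReal (M * ε') := by
        rw [Finset.sum_const, Finset.card_univ, Fintype.card_fin, nsmul_eq_mul,
          ENNReal.ofReal_mul (Nat.cast_nonneg M), ENNReal.ofReal_natCast]
    _ = ENNReal.ofReal ε := by
        congr 1
        rw [hε'_def]
        field_simp

/-- The crux from the two stubs (this is where the `sorry`s enter; `ShellCrossingBound_of` itself is sorry-free). -/
theorem ShellCrossingBound_proof :
    Summit.CriticalPhenomena.SAWScalingLimit.Theses.SAWRenewalTightness.ShellCrossingBound :=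
  ShellCrossingBound_of stub_confinementPositivity stub_bulkShellTight

end Summit.CriticalPhenomena.SAWScalingLimit.Cruxes.ShellCrossingBound.ConfinementBulkTightness

end
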